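import Summits.Langlands.Langlands.Theses.IrreducibilityBySelfDuality
import Summits.Langlands.Langlands.Theorems.IrreducibilityBySelfDualityIrreducibleOffSectorOfReciprocity
import Summits.Langlands.Langlands.Theorems.IrreducibilityBySelfDualityReciprocityUpToIrreducibility
import Summits.Langlands.Langlands.Theorems.IrreducibilityBySelfDualityPairLBoundaryJS
import Literature.NumberTheory.Automorphic.PairLFunctionPolesEqConjLandau
import Literature.NumberTheory.Automorphic.PairLFunctionPolesRepDataHolds
import HarnessLib

/-!
# The two open cruxes of route `IrreducibilityBySelfDuality` collapse to one (modulo Arthur–Clozel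
# (2.2)–(2.3)): `IrreducibleOffSector ⟸ ReciprocityUpToIrreducibility`, and `Langlands ↔
# ReciprocityUpToIrreducibility`
(crux stmt-Langlands-14329 `IrreducibleOffSector`, line `Sketch`; `--supports` file naming the route
decls — it imports the Theses file and is therefore NOT for use inside `closes`; the structural form
for `closes` is `irreducibleOffSector_text_of_reciprocityUpToIrreducibility_text` of
`…IrreducibleOffSectorOfReciprocity`)

* `IrreducibleOffSector_of_reciprocity` — the crux from the route items `PairLBoundaryJS`
  (Arthur–Clozel (2.2), = the named fact `JacquetShalika1981_partialPairL_boundary_repData`), the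
  named fact `JacquetShalika1981_partialPairL_pole_repData` (Arthur–Clozel (2.3)) and the crux
  `ReciprocityUpToIrreducibility` (stmt-Langlands-14328): the isobaric bootstrap.
* `langlands_iff_reciprocityUpToIrreducibility_of_JS` — granted (2.2)–(2.3), the summit is
  EQUIVALENT to `ReciprocityUpToIrreducibility` alone (p78886 certified `Langlands ↔ E ∧ I`; the
  bootstrap supplies `I` from `E`).
* `IrreducibleOffSector_of_reciprocity_of_moeglinWaldspurger` — the line introduces NO named fact
  beyond the leaves the route input `PairLBoundaryJS` already stands on: (2.3) for Borel–Jacquet data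
  follows from Mœglin–Waldspurger, Appendice, Corollaire (ii) alone
  (`JacquetShalika1981_partialPairL_pole_of_eq_conj_of_moeglinWaldspurger`,
  `JacquetShalika1981_partialPairL_pole_repData_of_rank`), and `PairLBoundaryJS` from Corollaire
  (i)(a), (i)(b), (ii) and multiplicity one (`PairLBoundaryJS_of_moeglinWaldspurger`); so the crux
  follows from `ReciprocityUpToIrreducibility` and that Mœglin–Waldspurger package.

References: F. Calegari, T. Gee, Ann. Inst. Fourier 63 (2013), §1.1; H. Jacquet, J. Shalika, Amer. J.
Math. 103 (1981) II, Thm. 4.4; J. Arthur, L. Clozel, Ann. of Math. Stud. 120, Ch. 3 §2.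
-/

noncomputable section

set_option linter.dupNamespace false

open scoped NumberField
open Filter IsDedekindDomain MeasureTheory
open Literature.NumberTheory.Automorphic Literature.NumberTheory.GaloisRepresentations
open Summit.Langlands
open Summit.Langlands.Langlands.Theses.IrreducibilityBySelfDuality

namespace Summit.Langlands.Langlands.Theorems.IrreducibleOffSector

/-- **`IrreducibleOffSector` from `ReciprocityUpToIrreducibility`** (and the route input
`PairLBoundaryJS` = Arthur–Clozel (2.2), and the named fact Arthur–Clozel (2.3) for Borel–Jacquet
data): the isobaric bootstrap `irreducibleOffSector_text_of_reciprocityUpToIrreducibility_text`, read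
on the route decls (each definitionally its text). [cite: CalegariGee2013, §1.1] -/
theorem IrreducibleOffSector_of_reciprocity (h22 : PairLBoundaryJS)
    (h23 : JacquetShalika1981_partialPairL_pole_repData) (hE : ReciprocityUpToIrreducibility) :
    IrreducibleOffSector :=
  irreducibleOffSector_text_of_reciprocityUpToIrreducibility_text h22 h23 hE

/-- **Granted Arthur–Clozel (2.2)–(2.3) for Borel–Jacquet data, the summit `Langlands` is equivalent
to the single crux `ReciprocityUpToIrreducibility`**: `Langlands ↔ E ∧ I`
(`langlands_iff_reciprocityUpToIrreducibility_and_irreducible`, p78886) and `E → I` by the isobaric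
bootstrap (`isIrreducible_of_reciprocityUpToIrreducibility`). [cite: CalegariGee2013, §1.1]
[cite: BuzzardGeeLMS2014, Conj. 3.2.1 and Conj. 3.2.2] -/
theorem langlands_iff_reciprocityUpToIrreducibility_of_JS (h22 : PairLBoundaryJS)
    (h23 : JacquetShalika1981_partialPairL_pole_repData) :
    _root_.Langlands ↔ ReciprocityUpToIrreducibility := by
  refine ⟨fun h =>
    (_root_.Summit.Langlands.Langlands.Theorems.ReciprocityUpToIrreducibility.langlands_iff_reciprocityUpToIrreducibility_and_irreducible.mp
      h).1,
    fun hE => ?_⟩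
  refine _root_.Summit.Langlands.Langlands.Theorems.ReciprocityUpToIrreducibility.langlands_iff_reciprocityUpToIrreducibility_and_irreducible.mpr
    ⟨hE, fun n K _ _ hcpt hn π hL ℓ _ ι ρ hρ => ?_⟩
  obtain ⟨Rec, hRec⟩ := hE K
  exact isIrreducible_of_reciprocityUpToIrreducibility h22 h23 hRec hcpt hn π hL ι ρ hρ

/-- **The crux from `ReciprocityUpToIrreducibility` and the Mœglin–Waldspurger package behind the
route input `PairLBoundaryJS`** (Appendice, Corollaire (i)(a) `…entire_of_rank_ne`, (i)(b)
`…entire_of_ne_conj`, (ii) `…of_eq_conj`, and `multiplicity_one_gl`, each granted at all ranks,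
number fields and automorphic measures): (2.2) for Borel–Jacquet data is
`PairLBoundaryJS_of_moeglinWaldspurger`, (2.3) is Corollaire (ii) alone through
`JacquetShalika1981_partialPairL_pole_of_eq_conj_of_moeglinWaldspurger` and
`JacquetShalika1981_partialPairL_pole_repData_of_rank`; then `IrreducibleOffSector_of_reciprocity`.
[cite: MoeglinWaldspurger1989, Appendice, Corollaire] [cite: CalegariGee2013, §1.1] -/
theorem IrreducibleOffSector_of_reciprocity_of_moeglinWaldspurger
    (hA : ∀ {n m : ℕ} {K : Type} [Field K] [NumberField K]
      {μ : Measure (AdelicGroupData.gl n K).automorphicQuotient}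
      [(AdelicGroupData.gl n K).IsAutomorphicMeasure μ]
      {μ' : Measure (AdelicGroupData.gl m K).automorphicQuotient}
      [(AdelicGroupData.gl m K).IsAutomorphicMeasure μ'],
      MoeglinWaldspurger1989_partialPairL_entire_of_rank_ne (n := n) (m := m) (K := K) (μ := μ)
        (μ' := μ'))
    (hB : ∀ {n : ℕ} {K : Type} [Field K] [NumberField K]
      {μ : Measure (AdelicGroupData.gl n K).automorphicQuotient}
      [(AdelicGroupData.gl n K).IsAutomorphicMeasure μ],
      MoeglinWaldspurger1989_partialPairL_entire_of_ne_conj (n := n) (K := K) (μ := μ))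
    (hC : ∀ {n : ℕ} {K : Type} [Field K] [NumberField K]
      {μ : Measure (AdelicGroupData.gl n K).automorphicQuotient}
      [(AdelicGroupData.gl n K).IsAutomorphicMeasure μ],
      MoeglinWaldspurger1989_partialPairL_of_eq_conj (n := n) (K := K) (μ := μ))
    (hm1 : ∀ (n : ℕ) (K : Type) [Field K] [NumberField K]
      (μ : Measure (AdelicGroupData.gl n K).automorphicQuotient)
      [(AdelicGroupData.gl n K).IsAutomorphicMeasure μ], multiplicity_one_gl n K μ)
    (hE : ReciprocityUpToIrreducibility) : IrreducibleOffSector :=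
  IrreducibleOffSector_of_reciprocity
    (Summit.Langlands.Langlands.Theorems.PairLBoundaryJS_of_moeglinWaldspurger hA hB hC hm1)
    (JacquetShalika1981_partialPairL_pole_repData_of_rank fun _ _ _ _ _ _ =>
      JacquetShalika1981_partialPairL_pole_of_eq_conj_of_moeglinWaldspurger hC)
    hE

end Summit.Langlands.Langlands.Theorems.IrreducibleOffSector

end
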